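import Summits.Parity.GeneralizedHardyLittlewood.Theorems.LeeYangFibresRelativeDimOneSplitClassVariance
import HarnessLib

/-!
# Moving class errors: the `ℓ¹` bound along a moving window
(crux stmt-Parity-14113 `LeeYangFibres.RelativeDimOne`, line gallagher-backwards-split, aux for stub
`stub_classMoments`)

`movingClassError`: from `LowClassSecondMoment θ₁` (hypothesis), for `0 ≤ θ₁' < θ₁ < 1`: for moduli
`q ≤ N^{θ₁'}`, a multiplier `0 < |a| ≤ L`, shifts `v, c` and a range `n < W` (`W ≥ δN`) on which the
heights `a n + v` stay in `[δN, LN]`,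
`∑_{n<W} |ψ(a n + v; q, a n + c) − 1_{(a n + c, q)=1} (a n + v)/φ(q)| ≤ ε W N/φ(q)` eventually in `N`.

Proof: Cauchy–Schwarz in `n`, then the `n`-range is cut into blocks of `m ≍ q/|a|` consecutive
integers. Inside a block the classes `a n + c mod q` are DISTINCT (`|a| (m-1) < q`) and the heights
move by `< q`, which changes a class error by `≤ 3 log(LN) + q/φ(q)` (at most three members of a class
in a range of length `< q`); so a block contributes `≤ 2 V + 2 m ω²` (`block_moving_sq_le`, stated for abstract class data `F`) where
`V = ∑_{r mod q} err(x_B; q, r)² ≤ ε' (LN)²/φ(q)` is the class variance at the block's base height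
(`classVariance_of_lowClassSecondMoment`, level transfer `q ≤ N^{θ₁'} ≤ (δN)^{θ₁}` for `N` large) and
`ω φ(q) ≤ εN/3`. With `≤ 2W/m` blocks and `1/m ≤ 2L/q ≤ 2L/φ(q)`:
`∑_n err² ≤ 8 ε' L³ W N²/φ² + 4 W ω² ≤ ε² W N²/φ²`, and `∑_n |err| ≤ √W · (∑_n err²)^{1/2} ≤ ε W N/φ(q)`.
-/

noncomputable section

open scoped BigOperators Classical Topology ArithmeticFunction.vonMangoldt
open Finset Filter Literature.NumberTheory.Sieve
open Summit.Parity.GeneralizedHardyLittlewood.Cruxes.RelativeDimOne.GallagherBackwards (classPsi)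

namespace Summit.Parity.GeneralizedHardyLittlewood.Cruxes.RelativeDimOne.GallagherBackwardsSplit

namespace ClassMomentsCore

/-! ### Differences of class sums over short ranges -/

/-- `ψ(y;q,r) − ψ(x;q,r) = ∑_{x < n ≤ y, n % q = r} Λ(n)` for `x ≤ y`. -/
theorem classPsi_sub_eq {x y : ℕ} (hxy : x ≤ y) (q r : ℕ) :
    classPsi y q r - classPsi x q r = ∑ n ∈ (Ioc x y).filter (fun n => n % q = r), Λ n := by
  have hIcc : ∀ z : ℕ, Icc 1 z = Ioc 0 z := fun z => by
    ext n; simp only [mem_Icc, mem_Ioc]; omega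
  have hdisj : Disjoint (Ioc 0 x) (Ioc x y) :=
    disjoint_left.2 fun n h1 h2 => by
      rw [mem_Ioc] at h1 h2; omega
  rw [classPsi, classPsi, hIcc, hIcc,
    ← Finset.Ioc_union_Ioc_eq_Ioc (Nat.zero_le x) hxy, filter_union,
    sum_union (disjoint_filter_filter hdisj)]
  ring

/-- A residue class has at most `(y − x)/q + 2` members in `(x, y]`. -/
theorem card_Ioc_filter_mod_le {x y : ℕ} (hxy : x ≤ y) {q : ℕ} (hq : 0 < q) (r : ℕ) :
    (#((Ioc x y).filter (fun n => n % q = r)) : ℝ) ≤ ((y : ℝ) - x) / q + 2 := by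
  set S := (Ioc x y).filter (fun n => n % q = r) with hS
  set X := (Ioc 0 x).filter (fun n => n ≡ r [MOD q]) with hX
  set Y := (Ioc 0 y).filter (fun n => n ≡ r [MOD q]) with hY
  have hSY : S ⊆ Y := by
    intro n hn
    rw [hS, mem_filter, mem_Ioc] at hn
    rw [hY, mem_filter, mem_Ioc]
    have hr : r < q := hn.2 ▸ Nat.mod_lt n hq
    refine ⟨⟨by omega, hn.1.2⟩, ?_⟩
    show n % q = r % q
    rw [Nat.mod_eq_of_lt hr, hn.2]
  have hXY : X ⊆ Y := by
    intro n hn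
    rw [hX, mem_filter, mem_Ioc] at hn
    rw [hY, mem_filter, mem_Ioc]
    exact ⟨⟨hn.1.1, hn.1.2.trans hxy⟩, hn.2⟩
  have hdisj : Disjoint S X := disjoint_left.2 fun n h1 h2 => by
    rw [hS, mem_filter, mem_Ioc] at h1
    rw [hX, mem_filter, mem_Ioc] at h2
    omega
  have hcard : #S + #X ≤ #Y := by
    rw [← card_union_of_disjoint hdisj]
    exact card_le_card (union_subset hSY hXY)
  have hcardR : (#S : ℝ) + #X ≤ #Y := by exact_mod_cast hcard
  have hy := (abs_le.1 (abs_card_Ioc_filter_modEq_sub_div_le y hq r)).2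
  have hx := (abs_le.1 (abs_card_Ioc_filter_modEq_sub_div_le x hq r)).1
  rw [← hY] at hy
  rw [← hX] at hx
  rw [sub_div]
  linarith

/-- Height wobble, ordered form: for `1 ≤ x ≤ y ≤ x + q` and `y ≤ Y`,
`|err(y;q,r) − err(x;q,r)| ≤ 3 log Y + q/φ(q)`. -/
theorem abs_classErr_sub_le {q x y : ℕ} (hq : 0 < q) (hxy : x ≤ y) (hyx : y ≤ x + q) (hx1 : 1 ≤ x)
    {Y : ℝ} (hY : (y : ℝ) ≤ Y) (r : ℕ) :
    |(classPsi y q r - if r.Coprime q then (y : ℝ) / Nat.totient q else 0) -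
        (classPsi x q r - if r.Coprime q then (x : ℝ) / Nat.totient q else 0)| ≤
      3 * Real.log Y + q / Nat.totient q := by
  have hy1 : 1 ≤ y := hx1.trans hxy
  have hy0 : (0 : ℝ) < y := by exact_mod_cast hy1
  have hlogY : Real.log y ≤ Real.log Y := Real.log_le_log hy0 hY
  have hlogy0 : 0 ≤ Real.log (y : ℝ) := Real.log_natCast_nonneg y
  have hqR : (0 : ℝ) < q := by exact_mod_cast hq
  have hφ0 : (0 : ℝ) < Nat.totient q := by exact_mod_cast Nat.totient_pos.2 hq
  -- the `ψ` difference
  have hψ0 : 0 ≤ classPsi y q r - classPsi x q r := by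
    rw [classPsi_sub_eq hxy]
    exact sum_nonneg fun n _ => ArithmeticFunction.vonMangoldt_nonneg
  have hψ : classPsi y q r - classPsi x q r ≤ 3 * Real.log Y := by
    rw [classPsi_sub_eq hxy]
    calc ∑ n ∈ (Ioc x y).filter (fun n => n % q = r), (Λ n : ℝ)
        ≤ ∑ n ∈ (Ioc x y).filter (fun n => n % q = r), Real.log y := by
          refine sum_le_sum fun n hn => ?_
          have hn' := mem_Ioc.1 (mem_filter.1 hn).1
          have hn0 : 0 < n := lt_of_le_of_lt (Nat.zero_le x) hn'.1
          exact ArithmeticFunction.vonMangoldt_le_log.trans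
            (Real.log_le_log (by exact_mod_cast hn0) (by exact_mod_cast hn'.2))
      _ = #((Ioc x y).filter (fun n => n % q = r)) * Real.log y := by
          rw [sum_const, nsmul_eq_mul]
      _ ≤ (((y : ℝ) - x) / q + 2) * Real.log y :=
          mul_le_mul_of_nonneg_right (card_Ioc_filter_mod_le hxy hq r) hlogy0
      _ ≤ 3 * Real.log y := by
          apply mul_le_mul_of_nonneg_right _ hlogy0
          have hyx' : (y : ℝ) ≤ x + q := by exact_mod_cast hyx
          have : ((y : ℝ) - x) / q ≤ 1 := by
            rw [div_le_one hqR]; linarith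
          linarith
      _ ≤ 3 * Real.log Y := by linarith
  -- the main-term difference
  have hmain : |(if r.Coprime q then (y : ℝ) / Nat.totient q else 0) -
      (if r.Coprime q then (x : ℝ) / Nat.totient q else 0)| ≤ q / Nat.totient q := by
    split_ifs
    · rw [← sub_div, abs_div, abs_of_pos hφ0]
      apply div_le_div_of_nonneg_right _ hφ0.le
      have h1 : (x : ℝ) ≤ y := by exact_mod_cast hxy
      have h2 : (y : ℝ) ≤ x + q := by exact_mod_cast hyx
      rw [abs_le]; constructor <;> linarith
    · rw [sub_zero, abs_zero]; positivity
  calc |classPsi y q r - (if r.Coprime q then (y : ℝ) / Nat.totient q else 0) -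
        (classPsi x q r - if r.Coprime q then (x : ℝ) / Nat.totient q else 0)|
      = |(classPsi y q r - classPsi x q r) -
          ((if r.Coprime q then (y : ℝ) / Nat.totient q else 0) -
            (if r.Coprime q then (x : ℝ) / Nat.totient q else 0))| := by ring_nf
    _ ≤ |classPsi y q r - classPsi x q r| +
          |(if r.Coprime q then (y : ℝ) / Nat.totient q else 0) -
            (if r.Coprime q then (x : ℝ) / Nat.totient q else 0)| := abs_sub _ _
    _ ≤ 3 * Real.log Y + q / Nat.totient q := by
        rw [abs_of_nonneg hψ0]
        exact add_le_add hψ hmain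

/-- Height wobble for integer heights `H, H₀ ≥ 1` with `|H − H₀| < q`, both `≤ Y`:
`|err(H;q,r) − err(H₀;q,r)| ≤ 3 log Y + q/φ(q)`. -/
theorem abs_classErr_toNat_sub_le {q : ℕ} (hq : 0 < q) {H H₀ : ℤ} (h1 : 1 ≤ H) (h1₀ : 1 ≤ H₀)
    (hd : (H - H₀).natAbs < q) {Y : ℝ} (hY : (H : ℝ) ≤ Y) (hY₀ : (H₀ : ℝ) ≤ Y) (r : ℕ) :
    |(classPsi H.toNat q r - if r.Coprime q then ((H.toNat : ℕ) : ℝ) / Nat.totient q else 0) -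
        (classPsi H₀.toNat q r - if r.Coprime q then ((H₀.toNat : ℕ) : ℝ) / Nat.totient q else 0)| ≤
      3 * Real.log Y + q / Nat.totient q := by
  have hyc : ((H.toNat : ℕ) : ℤ) = H := Int.toNat_of_nonneg (by linarith)
  have hxc : ((H₀.toNat : ℕ) : ℤ) = H₀ := Int.toNat_of_nonneg (by linarith)
  have habs : |H - H₀| < q := by
    rw [Int.abs_eq_natAbs]; exact_mod_cast hd
  obtain ⟨hlo, hhi⟩ := abs_lt.1 habs
  have hyR : ((H.toNat : ℕ) : ℝ) = (H : ℝ) := by rw [← Int.cast_natCast, hyc]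
  have hxR : ((H₀.toNat : ℕ) : ℝ) = (H₀ : ℝ) := by rw [← Int.cast_natCast, hxc]
  have hy1 : 1 ≤ H.toNat := by
    have : (1 : ℤ) ≤ (H.toNat : ℕ) := by rw [hyc]; exact h1
    exact_mod_cast this
  have hx1 : 1 ≤ H₀.toNat := by
    have : (1 : ℤ) ≤ (H₀.toNat : ℕ) := by rw [hxc]; exact h1₀
    exact_mod_cast this
  rcases le_total H₀.toNat H.toNat with h | h
  · have hyx : H.toNat ≤ H₀.toNat + q := by
      have : ((H.toNat : ℕ) : ℤ) ≤ (H₀.toNat : ℕ) + q := by rw [hyc, hxc]; linarith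
      exact_mod_cast this
    exact abs_classErr_sub_le hq h hyx hx1 (hyR ▸ hY) r
  · have hxy : H₀.toNat ≤ H.toNat + q := by
      have : ((H₀.toNat : ℕ) : ℤ) ≤ (H.toNat : ℕ) + q := by rw [hyc, hxc]; linarith
      exact_mod_cast this
    rw [abs_sub_comm]
    exact abs_classErr_sub_le hq h hxy hy1 (hxR ▸ hY₀) r

/-! ### Residues -/

/-- `resid q z < q` for `q ≥ 1`. -/
theorem resid_lt {q : ℕ} (hq : 0 < q) (z : ℤ) : resid q z < q := by
  unfold resid
  rw [Int.toNat_lt' hq]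
  exact Int.emod_lt_of_pos z (by exact_mod_cast hq)

/-- `resid q z` is the least non-negative residue of `z`. -/
theorem resid_cast {q : ℕ} (hq : 0 < q) (z : ℤ) : ((resid q z : ℕ) : ℤ) = z % q :=
  Int.toNat_of_nonneg (Int.emod_nonneg z (by exact_mod_cast hq.ne'))

/-- Coprimality of the residue is coprimality of the integer. -/
theorem coprime_resid_iff {q : ℕ} (hq : 0 < q) (z : ℤ) : (resid q z).Coprime q ↔ Int.gcd z q = 1 := by
  rw [← Int.gcd_emod, Int.gcd_eq_natAbs, Nat.Coprime, Int.natAbs_natCast]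
  have h : (z % q).natAbs = resid q z := by
    have : ((z % q).natAbs : ℤ) = (resid q z : ℕ) := by
      rw [Int.natAbs_of_nonneg (Int.emod_nonneg z (by exact_mod_cast hq.ne')), resid_cast hq]
    exact_mod_cast this
  rw [h]

/-- Two naturals in the same block of length `m ≥ 1` differ by at most `m − 1`. -/
theorem natAbs_sub_le_of_div_eq {m : ℕ} (hm : 0 < m) {n n' k : ℕ} (hn : n / m = k) (hn' : n' / m = k) :
    ((n' : ℤ) - n).natAbs ≤ m - 1 := by
  have h1 := Nat.div_add_mod n m
  have h2 := Nat.div_add_mod n' m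
  have h3 := Nat.mod_lt n hm
  have h4 := Nat.mod_lt n' hm
  rw [hn] at h1
  rw [hn'] at h2
  omega

/-- Inside a block the map `n ↦ a n + v` moves by `< q` when `|a| (m − 1) < q`. -/
theorem natAbs_mul_sub_lt {q m : ℕ} (hm : 0 < m) {a : ℤ} (hmq : a.natAbs * (m - 1) < q)
    {n n' k : ℕ} (hn : n / m = k) (hn' : n' / m = k) :
    (a * ((n' : ℤ) - n)).natAbs < q := by
  rw [Int.natAbs_mul]
  exact lt_of_le_of_lt (Nat.mul_le_mul_left _ (natAbs_sub_le_of_div_eq hm hn hn')) hmq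

/-- On a block of `m` consecutive integers with `|a| (m-1) < q`, `n ↦ (a n + c) mod q` is injective. -/
theorem resid_injOn {q : ℕ} (hq : 0 < q) {a : ℤ} (ha : a ≠ 0) (c : ℤ) {m : ℕ} (hm : 0 < m)
    (hmq : a.natAbs * (m - 1) < q) (k : ℕ) (S : Finset ℕ) (hS : ∀ n ∈ S, n / m = k) :
    Set.InjOn (fun n : ℕ => resid q (a * n + c)) S := by
  intro n hn n' hn' h
  have hmod : (a * n + c) % (q : ℤ) = (a * n' + c) % (q : ℤ) := by
    have := congrArg (fun t : ℕ => (t : ℤ)) h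
    simpa only [resid_cast hq] using this
  have hdvd : (q : ℤ) ∣ a * ((n' : ℤ) - n) := by
    have := Int.ModEq.dvd hmod
    have key : a * (n' : ℤ) + c - (a * n + c) = a * ((n' : ℤ) - n) := by ring
    rwa [key] at this
  have hlt : (a * ((n' : ℤ) - n)).natAbs < (q : ℤ).natAbs := by
    rw [Int.natAbs_natCast]
    exact natAbs_mul_sub_lt hm hmq (hS n hn) (hS n' hn')
  have hzero := Int.eq_zero_of_dvd_of_natAbs_lt_natAbs hdvd hlt
  rcases mul_eq_zero.1 hzero with h0 | h0
  · exact absurd h0 ha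
  · have : (n' : ℤ) = n := sub_eq_zero.1 h0
    exact_mod_cast this.symm

/-- `u² ≤ 2 w² + 2 (u − w)²`. -/
theorem sq_le_two_sq_add (u w : ℝ) : u ^ 2 ≤ 2 * w ^ 2 + 2 * (u - w) ^ 2 := by
  nlinarith [sq_nonneg (u - 2 * w)]

/-! ### The per-block estimate -/

end ClassMomentsCore

open ClassMomentsCore in
/-- **Per-block estimate for moving class data.** On a block `B` of integers `n` with `n / m = k`
(`#B ≤ m`, `|a| (m-1) < q`), for heights `H n` and class data `F x r` (think
`F x r = ψ(x; q, r) − 1_{(r,q)=1} x/φ(q)`) whose values wobble by `≤ ω` between heights of the block and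
whose class variance `∑_{r mod q} F(H n, r)²` is `≤ V` at every height of the block:
`∑_{n ∈ B} F(H n, (a n + c) mod q)² ≤ 2V + 2mω²` — the classes `(a n + c) mod q`, `n ∈ B`, are DISTINCT.
Registered auxiliary of stub `stub_classMoments`. -/
theorem block_moving_sq_le : ∀ (q : ℕ) (a c : ℤ) (m k : ℕ) (B : Finset ℕ) (H : ℕ → ℕ) (F : ℕ → ℕ → ℝ) (V ω : ℝ), 0 < q → a ≠ 0 → 0 < m → a.natAbs * (m - 1) < q → 0 ≤ V → 0 ≤ ω → (∀ n ∈ B, n / m = k) → B.card ≤ m → (∀ n ∈ B, ∀ n' ∈ B, ∀ r : ℕ, |F (H n) r - F (H n') r| ≤ ω) → (∀ n ∈ B, ∑ r ∈ Finset.range q, F (H n) r ^ 2 ≤ V) → ∑ n ∈ B, F (H n) (resid q (a * n + c)) ^ 2 ≤ 2 * V + 2 * m * ω ^ 2 := by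
  intro q a c m k B H F V ω hq ha hm hmq hV0 hω0 hB hBm hwob hvar
  rcases B.eq_empty_or_nonempty with rfl | ⟨n₀, hn₀⟩
  · rw [sum_empty]; positivity
  set ρ : ℕ → ℕ := fun n => resid q (a * n + c) with hρ
  have hpt : ∀ n ∈ B, F (H n) (ρ n) ^ 2 ≤ 2 * F (H n₀) (ρ n) ^ 2 + 2 * ω ^ 2 := by
    intro n hn
    have h1 := sq_le_two_sq_add (F (H n) (ρ n)) (F (H n₀) (ρ n))
    have h2 : (F (H n) (ρ n) - F (H n₀) (ρ n)) ^ 2 ≤ ω ^ 2 := by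
      have h3 := abs_le.1 (hwob n hn n₀ hn₀ (ρ n))
      exact sq_le_sq' h3.1 h3.2
    linarith
  have hinj : Set.InjOn ρ B := resid_injOn hq ha c hm hmq k B hB
  have himg : B.image ρ ⊆ range q :=
    image_subset_iff.2 fun n _ => mem_range.2 (resid_lt hq _)
  have hfib : ∑ n ∈ B, F (H n₀) (ρ n) ^ 2 ≤ ∑ r ∈ range q, F (H n₀) r ^ 2 := by
    calc ∑ n ∈ B, F (H n₀) (ρ n) ^ 2
        = ∑ r ∈ B.image ρ, F (H n₀) r ^ 2 :=
          (sum_image (f := fun r => F (H n₀) r ^ 2) hinj).symm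
      _ ≤ ∑ r ∈ range q, F (H n₀) r ^ 2 :=
          sum_le_sum_of_subset_of_nonneg himg fun _ _ _ => sq_nonneg _
  have hBmR : (#B : ℝ) ≤ m := by exact_mod_cast hBm
  calc ∑ n ∈ B, F (H n) (ρ n) ^ 2
      ≤ ∑ n ∈ B, (2 * F (H n₀) (ρ n) ^ 2 + 2 * ω ^ 2) := sum_le_sum hpt
    _ = 2 * ∑ n ∈ B, F (H n₀) (ρ n) ^ 2 + 2 * #B * ω ^ 2 := by
        rw [sum_add_distrib, ← mul_sum, sum_const, nsmul_eq_mul]; ring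
    _ ≤ 2 * ∑ r ∈ range q, F (H n₀) r ^ 2 + 2 * m * ω ^ 2 := by
        have h1 : 2 * (#B : ℝ) * ω ^ 2 ≤ 2 * m * ω ^ 2 := by
          have : 0 ≤ ω ^ 2 := sq_nonneg ω
          nlinarith
        linarith
    _ ≤ 2 * V + 2 * m * ω ^ 2 := by linarith [hvar n₀ hn₀]

end Summit.Parity.GeneralizedHardyLittlewood.Cruxes.RelativeDimOne.GallagherBackwardsSplit
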